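import Literature.AnabelianGeometry.EtaleTheta.BiKummerThm44SubModelPairsWeak
import Literature.AnabelianGeometry.EtaleTheta.BiKummerThm44SubModelPull
import Literature.AnabelianGeometry.EtaleTheta.Discharge.Sec4Thm44OfConnectedTemperoid

/-!
# [EtTh] Theorem 4.4 (i), (ii), (iii) and the `N`-th-roots clause at the WEAK monoid vocabulary
# `treeMonoidVocabWeak` — for the canonical model instances and at the genuine connected base; proof-only

S. Mochizuki, *The étale theta function …*, Publ. RIMS **45** (2009) [MochizukiEtTh2009], §4, Thm 4.4 (PDF
pp.93–95); S. Mochizuki, *The geometry of Frobenioids I* [MochizukiFrdI2008], Def. 2.4 (i) p.47 (perf-factorial).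

abc-iut cell, layer L2, sub-DAG `plan/L2/SUBDAG-EtTh-Thm44.md` (custodian abc-iut-w5-d179).  PROOF-ONLY companion
(seat abc-iut-w6-d037, gen 2): no definition, no named fact, nothing restated.

WHY.  Every canonical-vocabulary closer of the Thm 4.4 chain in the tree — T44-L03
`Thm44Hyp.preservesFrobeniusStructure_treeVocab`, Thm 4.4 (ii) `thm44_ii_mkOfModelCanonical`, T44-L14
`Thm44Hyp.preservesNthRoots_mkOfModelCanonical` (abc-iut-w5-d179), Thm 4.4 (i)/(iii)
`thm44_i_treeVocab` / `thm44_iii_treeVocab`, and the consolidated `thm44_mkOfConnectedTemperoid` at the genuine base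
`B^temp(Π^tp_X)⁰` (p431376) — is stated over realified data `T_i : RealifiedDivisorMonoids treeMonoidVocab`, i.e. with
"`Φ` perf-factorial" read AS PRINTED ([FrdI] Def. 2.4 (i)(a)–(d)) at EVERY object.  Cell finding F-L2d2-1
(abc-iut-L2-d2; kernel witness `not_isPerfFactorial_multiplicative_pi_nat`, p413961): at the tempered coverings
with infinitely many special-fibre components — `Ÿ`, `Z_∞`, the objects §§4–5 are about — clause (d) FAILS, so no
such `T_i` packages the genuine divisor monoids; the vocabulary of record there is abc-iut-L2-t3's
`treeMonoidVocabWeak` (`FrdIVocabularyWeak.lean`: "perf-factorial" := `IsPerfFactorialCof`).  The underlying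
`_of_inputs` / `_of_remark372` / `_of_thm34` theorems of the chain are vocabulary-generic; the strong vocabulary
entered only through (α) the unfolding of "`Φ_i` non-dilating" (`isNonDilatingOn_ofFunctor_i`, identical at the weak
vocabulary: abc-iut-L2-d2's `isNonDilatingOn_iff_pull_weak`) and (β) the perf-factorial binder of T44-L04 — removed
in `BiKummerThm44SubModelPairsWeak.lean` (this seat, p432676: [FrdI] Cor 5.7 (i) over slim FSM-type bases needs
no perf-factoriality).  Hence the whole chain at the weak vocabulary, with the SAME residual inputs as the strong
closers:

* `Thm44Hyp.isNonDilatingOn_ofFunctor₁/₂_weak` (α), `Thm44Hyp.preservesFrobeniusStructure_treeVocabWeak` (T44-L03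
  ⇐ {`Remark372 D₀ / D₀'`, `hBmon₁ / hBmon₂`});
* `Thm44Hyp.thm44_i_treeVocabWeak` (Thm 4.4 (i) ⇐ the same + T44-L09c `GaloisCompatible` + T44-L09
  `HodotCompatible`), `Thm44Hyp.thm44_iii_treeVocabWeak` (Thm 4.4 (iii) ⇐ the same + T44-L15b),
  `thm44_ii_treeVocabWeak_of_frac` (Thm 4.4 (ii) ⇐ the same + the fraction clause of T44-L10 for `ψ`);
* for the canonical model instances `mkOfModelCanonical` with the CONSTRUCTED `ψ = Ψ^birat` (`psiModel`,
  abc-iut-w5-d179) and the model pull-backs: `thm44_ii_mkOfModelCanonical_treeVocabWeak` ⇐ {`Remark372` ×2, `hBmon`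
  ×2}, **`Thm44Hyp.preservesNthRoots_mkOfModelCanonical_treeVocabWeak`** (T44-L14 ⇐ the same + T44-L09c + T44-L15b;
  NO perf-factorial binder), `Thm44Hyp.thm44_mkOfModelCanonical_treeVocabWeak` (consolidated);
* at the genuine connected base `mkOfConnectedTemperoid` (abc-iut-L2-t4), where T44-L09 / T44-L09c are
  abc-iut-w5-d013's theorems ([SemiAnbd] Prop 3.2): `Thm44Hyp.thm44_i/ii/iii_mkOfConnectedTemperoid_treeVocabWeak`,
  `Thm44Hyp.preservesNthRoots_mkOfConnectedTemperoid_treeVocabWeak`, and **`Thm44Hyp.thm44_mkOfConnectedTemperoid_treeVocabWeak`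
  : (i) ∧ (ii) ∧ (iii) ∧ (`N`-th roots) ⇐ {`Remark372 D₀ / D₀'` (Rmk 3.7.2, named fact), `hBmon₁ / hBmon₂` (Def 3.6
  (ii) datum "`𝔹` a monoid on `D`"), T44-L15b ([FrdII] Def 2.2 (ii))} ONLY** — the weak-vocabulary twin of
  abc-iut-w5-d179's `thm44_mkOfConnectedTemperoid`, with the same three residual inputs and no other.
Statements name the vocabulary (`(V := treeMonoidVocabWeak)`) where they would otherwise read as their strong twins.
HONEST FRAMING: refereed pre-IUT material ([EtTh] §4 over [FrdI] §§2–5, [SemiAnbd] §3); no new `Prop` fact; nothing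
here asserts that such data exist for an actual curve; nothing here bears on [IUTchIII] Cor. 3.12; typed ≠ proved —
here PROVED.
-/

noncomputable section

namespace Literature.AnabelianGeometry.EtaleTheta

open CategoryTheory Opposite Literature.AlgebraicGeometry.Frobenioids Literature.AnabelianGeometry.SemiGraphs

namespace BiKummerSetting

universe u₀ v₀ u v w

/-! ### Settings over the weak realified data and the canonical category vocabulary -/

section TreeVocabWeak

variable {K : Type u₀} [Field K] {K' : Type u₀} [Field K'] {D₀ : Type u₀} [Category.{v₀} D₀]
  {X₁ : SemiGraphs.TemperedArithmeticGroup.{u₀} K} {X₂ : SemiGraphs.TemperedArithmeticGroup.{u₀} K'}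
  {D₀' : Type u₀} [Category.{v₀} D₀']
  {T₁ : RealifiedDivisorMonoids (D₀ := D₀) treeMonoidVocabWeak.{w}}
  {T₂ : RealifiedDivisorMonoids (D₀ := D₀') treeMonoidVocabWeak.{w}}
  {D₁ D₂ : Type u} [Category.{v} D₁] [Category.{v} D₂]
  {IsRational₁ IsStrictlyRational₁ : (D₁ᵒᵖ ⥤ CommMonCat.{w}) → Prop}
  {IsRational₂ IsStrictlyRational₂ : (D₂ᵒᵖ ⥤ CommMonCat.{w}) → Prop}

section Settings

variable {S₁ : BiKummerSetting X₁ T₁ D₁ (treeCatVocab D₁ IsRational₁ IsStrictlyRational₁)}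
  {S₂ : BiKummerSetting X₂ T₂ D₂ (treeCatVocab D₂ IsRational₂ IsStrictlyRational₂)}

/-- At the weak monoid vocabulary, "`Φ₁` non-dilating" (field `Thm44Hyp.isNonDilating₁`; `treeMonoidVocabWeak.IsNonDilating`
is the tree's `IsNonDilating`) is the [FrdI] Def 1.1 (ii) property of the pre-Frobenioid structure `C₁ → F_{Φ₁}` — the
weak twin of `Thm44Hyp.isNonDilatingOn_ofFunctor₁`. [cite: MochizukiEtTh2009, Thm 4.4 p.93] -/
theorem Thm44Hyp.isNonDilatingOn_ofFunctor₁_weak (h : Thm44Hyp S₁ S₂) :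
    PreFrobenioidData.IsNonDilatingOn
      (PreFrobenioidData.ofFunctor (BiKummerSetting.tf (V := treeMonoidVocabWeak.{w}) S₁).divisorMonoid S₁.F) :=
  ⟨fun X f => (PreFrobenioidData.isNonDilating_iff_isNonDilating _).mpr (h.isNonDilating₁ (op X) f.op)⟩

/-- At the weak monoid vocabulary, "`Φ₂` non-dilating" is the [FrdI] Def 1.1 (ii) property of `C₂ → F_{Φ₂}`.
[cite: MochizukiEtTh2009, Thm 4.4 p.93] -/
theorem Thm44Hyp.isNonDilatingOn_ofFunctor₂_weak (h : Thm44Hyp S₁ S₂) :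
    PreFrobenioidData.IsNonDilatingOn
      (PreFrobenioidData.ofFunctor (BiKummerSetting.tf (V := treeMonoidVocabWeak.{w}) S₂).divisorMonoid S₂.F) :=
  ⟨fun X f => (PreFrobenioidData.isNonDilating_iff_isNonDilating _).mpr (h.isNonDilating₂ (op X) f.op)⟩

/-- **T44-L03 at the weak vocabulary, inputs `Remark372 D₀ / D₀'` and `hBmon₁ / hBmon₂` only**: `Ψ` preserves
Frobenius degrees, isometries, morphisms of Frobenius type and pull-backs ([FrdI] Thm 3.4 (ii), (iii) over FSM-type
bases, abc-iut-L1; "`C_i` Frobenioid" ⇐ `hBmon_i`, "`D_i` of FSM-type" ⇐ Rmk 3.7.2, "`Φ_i` non-dilating" = the Thm 4.4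
hypothesis) — weak twin of `preservesFrobeniusStructure_treeVocab`. [cite: MochizukiEtTh2009, Thm 4.4 p.95] -/
theorem Thm44Hyp.preservesFrobeniusStructure_treeVocabWeak (h : Thm44Hyp S₁ S₂)
    (h372 : TemperedFrobenioid.Remark372 D₀) (h372' : TemperedFrobenioid.Remark372 D₀')
    (hBmon₁ : IsMonoidOn S₁.tf.ratFnFunctor) (hBmon₂ : IsMonoidOn S₂.tf.ratFnFunctor) :
    Thm44Hyp.PreservesFrobeniusStructure (V := treeMonoidVocabWeak.{w}) h :=
  h.preservesFrobeniusStructure_of_thm34 (S₁.tf.isFrobenioid_treeCatVocab_of_isMonoidOn hBmon₁)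
    (S₂.tf.isFrobenioid_treeCatVocab_of_isMonoidOn hBmon₂) (h.isOfFSMType_base₁ h372.2.1)
    (h.isOfFSMType_base₂ h372'.2.1) h.isNonDilatingOn_ofFunctor₁_weak h.isNonDilatingOn_ofFunctor₂_weak

/-- **Thm 4.4 (i) at the weak vocabulary**: `Thm44_i h` ⇐ {`Remark372 D₀ / D₀'` (Rmk 3.7.2), `hBmon₁ / hBmon₂`, T44-L09c
`GaloisCompatible`, T44-L09 `HodotCompatible` ([SemiAnbd] Prop 3.2 / Thm A.4 over the free Galois data)} —
abc-iut-L2-t3's `thm44_i_of_remark372` with "`C_i` Frobenioid" from `hBmon_i` ([FrdI] Thm 5.2 (ii)).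
[cite: MochizukiEtTh2009, Thm 4.4 (i) p.94] -/
theorem Thm44Hyp.thm44_i_treeVocabWeak (h : Thm44Hyp S₁ S₂)
    (h372 : TemperedFrobenioid.Remark372 D₀) (h372' : TemperedFrobenioid.Remark372 D₀')
    (hBmon₁ : IsMonoidOn S₁.tf.ratFnFunctor) (hBmon₂ : IsMonoidOn S₂.tf.ratFnFunctor)
    (h9c : h.GaloisCompatible) (h9 : h.HodotCompatible) : Thm44_i (V := treeMonoidVocabWeak.{w}) h :=
  h.thm44_i_of_remark372 (S₁.tf.isFrobenioid_treeCatVocab_of_isMonoidOn hBmon₁)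
    (S₂.tf.isFrobenioid_treeCatVocab_of_isMonoidOn hBmon₂) h372 h372' h.isNonDilatingOn_ofFunctor₁_weak
    h.isNonDilatingOn_ofFunctor₂_weak h9c h9

/-- **Thm 4.4 (iii) (saturation clause) at the weak vocabulary**: `Thm44_iii h ψ` ⇐ {`Remark372 D₀ / D₀'`, `hBmon₁ /
hBmon₂`, T44-L15b `PreservesNHSaturatedBsFld`} — abc-iut-L2-t3's `thm44_iii_of_remark372`.
[cite: MochizukiEtTh2009, Thm 4.4 (iii) p.94] -/
theorem Thm44Hyp.thm44_iii_treeVocabWeak (h : Thm44Hyp S₁ S₂)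
    (ψ : ∀ A : S₁.C, S₁.biratUnits A ≃* S₂.biratUnits (h.Ψ.functor.obj A))
    (h372 : TemperedFrobenioid.Remark372 D₀) (h372' : TemperedFrobenioid.Remark372 D₀')
    (hBmon₁ : IsMonoidOn S₁.tf.ratFnFunctor) (hBmon₂ : IsMonoidOn S₂.tf.ratFnFunctor)
    (h15 : h.PreservesNHSaturatedBsFld) : Thm44_iii (V := treeMonoidVocabWeak.{w}) h ψ :=
  h.thm44_iii_of_remark372 ψ (S₁.tf.isFrobenioid_treeCatVocab_of_isMonoidOn hBmon₁)
    (S₂.tf.isFrobenioid_treeCatVocab_of_isMonoidOn hBmon₂) h372 h372' h.isNonDilatingOn_ofFunctor₁_weak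
    h.isNonDilatingOn_ofFunctor₂_weak h15

/-- **Thm 4.4 (ii), fraction-pair clause, at the weak vocabulary** for settings reading Def 4.1 (i) as the [FrdI]
Prop 4.1 (iii) predicate: `Thm44_ii h ψ` ⇐ {`Remark372 D₀ / D₀'`, `hBmon₁ / hBmon₂`, the fraction clause of T44-L10
([FrdI] Cor 4.10) for `ψ`} — T44-L03 (`preservesFrobeniusStructure_treeVocabWeak`) and T44-L12 (print's form,
`disjointSupports_map_of_inputs`, [FrdI] Thm 4.2 (ii)) discharged; weak twin of `thm44_ii_treeVocab_of_frac`.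
[cite: MochizukiEtTh2009, Thm 4.4 (ii) p.94] -/
theorem thm44_ii_treeVocabWeak_of_frac (h : Thm44Hyp S₁ S₂)
    (ψ : ∀ A : S₁.C, S₁.biratUnits A ≃* S₂.biratUnits (h.Ψ.functor.obj A))
    (hS₁ : ∀ {A : D₁ᵒᵖ} (a b : S₁.tf.Φ.carrier A), S₁.DisjointSupports a b →
      ∀ x : S₁.tf.Φ.carrier A, x ∣ a → x ∣ b → x = 1)
    (hS₂ : ∀ {A : D₂ᵒᵖ} (a b : S₂.tf.Φ.carrier A), (∀ x : S₂.tf.Φ.carrier A, x ∣ a → x ∣ b → x = 1) →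
      S₂.DisjointSupports a b)
    (h372 : TemperedFrobenioid.Remark372 D₀) (h372' : TemperedFrobenioid.Remark372 D₀')
    (hBmon₁ : IsMonoidOn S₁.tf.ratFnFunctor) (hBmon₂ : IsMonoidOn S₂.tf.ratFnFunctor)
    (hfrac : ∀ {A B : S₁.C} (s' s'' : A ⟶ B) (h' : S₁.IsPreStep s') (h'' : S₁.IsPreStep s'')
      (hb : PreFrobenioid.BaseEquivalent S₁.F s' s'') (k' : S₂.IsPreStep (h.Ψ.functor.map s'))
      (k'' : S₂.IsPreStep (h.Ψ.functor.map s''))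
      (kb : PreFrobenioid.BaseEquivalent S₂.F (h.Ψ.functor.map s') (h.Ψ.functor.map s'')),
      S₂.fracOf (h.Ψ.functor.map s') (h.Ψ.functor.map s'') k' k'' kb = ψ A (S₁.fracOf s' s'' h' h'' hb)) :
    Thm44_ii (V := treeMonoidVocabWeak.{w}) h ψ :=
  thm44_ii_of_preSteps h ψ
    (fun _ hs => h.isPreStep_map (h.preservesFrobeniusStructure_treeVocabWeak h372 h372' hBmon₁ hBmon₂) hs) hfrac
    (fun s' s'' h' h'' hb hds => h.disjointSupports_map_of_inputs hS₁ hS₂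
      (S₁.tf.isFrobenioid_treeCatVocab_of_isMonoidOn hBmon₁) (S₂.tf.isFrobenioid_treeCatVocab_of_isMonoidOn hBmon₂)
      (h.preservesFrobeniusStructure_treeVocabWeak h372 h372' hBmon₁ hBmon₂) s' s'' h' h'' hb hds)

end Settings

/-! ### The canonical model instances `mkOfModelCanonical` over the weak vocabulary -/

section Model

variable {tf₁ : TemperedFrobenioid T₁ D₁ (treeCatVocab D₁ IsRational₁ IsStrictlyRational₁)}
  {hZ₁ : tf₁.monoidType = MonoidType.Z} {hP₁ : ∀ A : D₁ᵒᵖ, IsPerfect (tf₁.Φ.carrier A)}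
  {IG₁ : D₁ → Prop} {gS₁ : ∀ A : D₁, IG₁ A → (X₁.Pi →* Aut A)}
  {gSs₁ : ∀ (A : D₁) (hA : IG₁ A), Function.Surjective (gS₁ A hA)}
  {NH₁ : Subgroup (Field.absoluteGaloisGroup K) → tf₁.category → ℕ+ → Prop} {A₀₁ : tf₁.category}
  {hA₀₁ : PreFrobenioid.IsFrobeniusTrivial tf₁.toElem A₀₁} {hA₀₁' : IG₁ A₀₁.base}
  {tf₂ : TemperedFrobenioid T₂ D₂ (treeCatVocab D₂ IsRational₂ IsStrictlyRational₂)}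
  {hZ₂ : tf₂.monoidType = MonoidType.Z} {hP₂ : ∀ A : D₂ᵒᵖ, IsPerfect (tf₂.Φ.carrier A)}
  {IG₂ : D₂ → Prop} {gS₂ : ∀ A : D₂, IG₂ A → (X₂.Pi →* Aut A)}
  {gSs₂ : ∀ (A : D₂) (hA : IG₂ A), Function.Surjective (gS₂ A hA)}
  {NH₂ : Subgroup (Field.absoluteGaloisGroup K') → tf₂.category → ℕ+ → Prop} {A₀₂ : tf₂.category}
  {hA₀₂ : PreFrobenioid.IsFrobeniusTrivial tf₂.toElem A₀₂} {hA₀₂' : IG₂ A₀₂.base}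

/-- **[EtTh] Thm 4.4 (ii), fraction-pair clause, for the canonical model instances over the WEAK vocabulary** with the
CONSTRUCTED `ψ = Ψ^birat` (`psiModel`) ⇐ {Rmk 3.7.2 (`Remark372 D₀ / D₀'`), `hBmon₁ / hBmon₂`} ONLY — T44-L03, T44-L10
([FrdI] Cor 4.10: `biratCompatible_mkOfModel`), T44-L12 discharged; weak twin of `thm44_ii_mkOfModelCanonical`.
[cite: MochizukiEtTh2009, Thm 4.4 (ii) p.94] -/
theorem thm44_ii_mkOfModelCanonical_treeVocabWeak
    (h : Thm44Hyp (mkOfModelCanonical X₁ tf₁ hZ₁ hP₁ IG₁ gS₁ gSs₁ NH₁ A₀₁ hA₀₁ hA₀₁')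
      (mkOfModelCanonical X₂ tf₂ hZ₂ hP₂ IG₂ gS₂ gSs₂ NH₂ A₀₂ hA₀₂ hA₀₂'))
    (h372 : TemperedFrobenioid.Remark372 D₀) (h372' : TemperedFrobenioid.Remark372 D₀')
    (hBmon₁ : IsMonoidOn tf₁.ratFnFunctor) (hBmon₂ : IsMonoidOn tf₂.ratFnFunctor) :
    Thm44_ii h (h.psiModel (tf₁.isFrobenioid_treeCatVocab_of_isMonoidOn hBmon₁)
      (tf₂.isFrobenioid_treeCatVocab_of_isMonoidOn hBmon₂)
      (h.preservesFrobeniusStructure_treeVocabWeak h372 h372' hBmon₁ hBmon₂)) :=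
  thm44_ii_treeVocabWeak_of_frac h _ (fun _ _ hab => hab) (fun _ _ hab => hab) h372 h372' hBmon₁ hBmon₂
    fun s' s'' h' h'' hb k' k'' kb =>
    (h.biratCompatible_mkOfModel (tf₁.isFrobenioid_treeCatVocab_of_isMonoidOn hBmon₁)
      (tf₂.isFrobenioid_treeCatVocab_of_isMonoidOn hBmon₂)
      (h.preservesFrobeniusStructure_treeVocabWeak h372 h372' hBmon₁ hBmon₂)).frac s' s'' h' h'' hb k' k'' kb

/-- **T44-L14 "`Ψ` maps `N`-th roots of fraction-pairs to `N`-th roots of fraction-pairs" ([EtTh] Thm 4.4 (ii), last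
sentence) for the canonical model instances over the WEAK vocabulary**, for the CONSTRUCTED `ψ = Ψ^birat` (`psiModel`)
and the model pull-backs `pullFracModel` ⇐ {Rmk 3.7.2 (`Remark372 D₀ / D₀'`), `hBmon₁ / hBmon₂`, T44-L09c
(`GaloisCompatible`, [SemiAnbd] Prop 3.2), T44-L15b (`PreservesNHSaturatedBsFld`, [FrdII] Def 2.2 (ii))} — NO
perf-factorial binder: the weak twin of abc-iut-w5-d179's `preservesNthRoots_mkOfModelCanonical` (same proof, T44-L04
supplied by `preservesBaseFrobeniusPairs_mkOfModelCanonical_treeVocabWeak`). [cite: MochizukiEtTh2009, Thm 4.4 (ii) p.94] -/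
theorem Thm44Hyp.preservesNthRoots_mkOfModelCanonical_treeVocabWeak
    (h : Thm44Hyp (mkOfModelCanonical X₁ tf₁ hZ₁ hP₁ IG₁ gS₁ gSs₁ NH₁ A₀₁ hA₀₁ hA₀₁')
      (mkOfModelCanonical X₂ tf₂ hZ₂ hP₂ IG₂ gS₂ gSs₂ NH₂ A₀₂ hA₀₂ hA₀₂'))
    (h372 : TemperedFrobenioid.Remark372 D₀) (h372' : TemperedFrobenioid.Remark372 D₀')
    (hBmon₁ : IsMonoidOn tf₁.ratFnFunctor) (hBmon₂ : IsMonoidOn tf₂.ratFnFunctor)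
    (h9 : h.GaloisCompatible) (h15 : h.PreservesNHSaturatedBsFld) :
    h.PreservesNthRoots (h.psiModel (tf₁.isFrobenioid_treeCatVocab_of_isMonoidOn hBmon₁)
      (tf₂.isFrobenioid_treeCatVocab_of_isMonoidOn hBmon₂)
      (h.preservesFrobeniusStructure_treeVocabWeak h372 h372' hBmon₁ hBmon₂))
      (fun φ f => tf₁.pullFracModel φ f) (fun φ f => tf₂.pullFracModel φ f) :=
  h.preservesNthRoots_of
    (h.psiModel (tf₁.isFrobenioid_treeCatVocab_of_isMonoidOn hBmon₁) (tf₂.isFrobenioid_treeCatVocab_of_isMonoidOn hBmon₂)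
      (h.preservesFrobeniusStructure_treeVocabWeak h372 h372' hBmon₁ hBmon₂))
    (fun φ f => tf₁.pullFracModel φ f) (fun φ f => tf₂.pullFracModel φ f)
    (fun φ f => h.psiModel_pullFracModel (tf₁.isFrobenioid_treeCatVocab_of_isMonoidOn hBmon₁)
      (tf₂.isFrobenioid_treeCatVocab_of_isMonoidOn hBmon₂)
      (h.preservesFrobeniusStructure_treeVocabWeak h372 h372' hBmon₁ hBmon₂) φ f)
    (thm44_ii_mkOfModelCanonical_treeVocabWeak h h372 h372' hBmon₁ hBmon₂)
    (h.preservesFrobeniusStructure_treeVocabWeak h372 h372' hBmon₁ hBmon₂)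
    (h.preservesBaseFrobeniusTypeData_of_inputs (h.preservesFrobeniusStructure_treeVocabWeak h372 h372' hBmon₁ hBmon₂)
      (Thm44Hyp.preservesBaseFrobeniusPairs_mkOfModelCanonical_treeVocabWeak _ _ _ _ _ _ _ _ _ _ _ _ _ _ _ _ _ _ _ _
        h h372 h372' hBmon₁ hBmon₂) h9)
    (h.preservesAmple_of h9)
    (h.preservesFixedByHA_of _ h9 (h.biratCompatible_mkOfModel (tf₁.isFrobenioid_treeCatVocab_of_isMonoidOn hBmon₁)
      (tf₂.isFrobenioid_treeCatVocab_of_isMonoidOn hBmon₂)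
      (h.preservesFrobeniusStructure_treeVocabWeak h372 h372' hBmon₁ hBmon₂)))
    (h.preservesSaturated_of _ (h.preservesFrobeniusStructure_treeVocabWeak h372 h372' hBmon₁ hBmon₂) h15)

/-- **[EtTh] Theorem 4.4 for the canonical model instances over the WEAK vocabulary, consolidated**: (i) ∧ (ii)
(fraction-pairs) ∧ (iii) (saturation) ∧ (ii) (`N`-th roots), for `ψ = Ψ^birat` and the model pull-backs — modulo
{Rmk 3.7.2, `hBmon₁ / hBmon₂`, T44-L09c `GaloisCompatible`, T44-L09 `HodotCompatible`, T44-L15b}.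
[cite: MochizukiEtTh2009, Thm 4.4 p.94] -/
theorem Thm44Hyp.thm44_mkOfModelCanonical_treeVocabWeak
    (h : Thm44Hyp (mkOfModelCanonical X₁ tf₁ hZ₁ hP₁ IG₁ gS₁ gSs₁ NH₁ A₀₁ hA₀₁ hA₀₁')
      (mkOfModelCanonical X₂ tf₂ hZ₂ hP₂ IG₂ gS₂ gSs₂ NH₂ A₀₂ hA₀₂ hA₀₂'))
    (h372 : TemperedFrobenioid.Remark372 D₀) (h372' : TemperedFrobenioid.Remark372 D₀')
    (hBmon₁ : IsMonoidOn tf₁.ratFnFunctor) (hBmon₂ : IsMonoidOn tf₂.ratFnFunctor)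
    (h9c : h.GaloisCompatible) (h9 : h.HodotCompatible) (h15 : h.PreservesNHSaturatedBsFld) :
    Thm44_i h ∧
      Thm44_ii h (h.psiModel (tf₁.isFrobenioid_treeCatVocab_of_isMonoidOn hBmon₁)
        (tf₂.isFrobenioid_treeCatVocab_of_isMonoidOn hBmon₂)
        (h.preservesFrobeniusStructure_treeVocabWeak h372 h372' hBmon₁ hBmon₂)) ∧
      Thm44_iii h (h.psiModel (tf₁.isFrobenioid_treeCatVocab_of_isMonoidOn hBmon₁)
        (tf₂.isFrobenioid_treeCatVocab_of_isMonoidOn hBmon₂)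
        (h.preservesFrobeniusStructure_treeVocabWeak h372 h372' hBmon₁ hBmon₂)) ∧
      h.PreservesNthRoots (h.psiModel (tf₁.isFrobenioid_treeCatVocab_of_isMonoidOn hBmon₁)
        (tf₂.isFrobenioid_treeCatVocab_of_isMonoidOn hBmon₂)
        (h.preservesFrobeniusStructure_treeVocabWeak h372 h372' hBmon₁ hBmon₂))
        (fun φ f => tf₁.pullFracModel φ f) (fun φ f => tf₂.pullFracModel φ f) :=
  ⟨h.thm44_i_treeVocabWeak h372 h372' hBmon₁ hBmon₂ h9c h9,
    thm44_ii_mkOfModelCanonical_treeVocabWeak h h372 h372' hBmon₁ hBmon₂,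
    h.thm44_iii_treeVocabWeak _ h372 h372' hBmon₁ hBmon₂ h15,
    h.preservesNthRoots_mkOfModelCanonical_treeVocabWeak h372 h372' hBmon₁ hBmon₂ h9c h15⟩

end Model

end TreeVocabWeak

/-! ### At the genuine connected base `B^temp(Π^tp_X)⁰` (`mkOfConnectedTemperoid`) over the weak vocabulary -/

section Connected

variable {K : Type u₀} [Field K] {K' : Type u₀} [Field K'] {X₁ : SemiGraphs.TemperedArithmeticGroup.{u₀} K}
  {X₂ : SemiGraphs.TemperedArithmeticGroup.{u₀} K'} {D₀ : Type u₀} [Category.{v₀} D₀] {D₀' : Type u₀}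
  [Category.{v₀} D₀'] {T₁ : RealifiedDivisorMonoids (D₀ := D₀) treeMonoidVocabWeak.{w}}
  {T₂ : RealifiedDivisorMonoids (D₀ := D₀') treeMonoidVocabWeak.{w}}
  {IsRational₁ IsStrictlyRational₁ : ((ConnectedPart (BTemp X₁.Pi))ᵒᵖ ⥤ CommMonCat.{w}) → Prop}
  {IsRational₂ IsStrictlyRational₂ : ((ConnectedPart (BTemp X₂.Pi))ᵒᵖ ⥤ CommMonCat.{w}) → Prop}
  {tf₁ : TemperedFrobenioid T₁ (ConnectedPart (BTemp X₁.Pi))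
    (treeCatVocab (ConnectedPart (BTemp X₁.Pi)) IsRational₁ IsStrictlyRational₁)}
  {hZ₁ : tf₁.monoidType = MonoidType.Z} {hP₁ : ∀ A : (ConnectedPart (BTemp X₁.Pi))ᵒᵖ, IsPerfect (tf₁.Φ.carrier A)}
  {NH₁ : Subgroup (Field.absoluteGaloisGroup K) → tf₁.category → ℕ+ → Prop} {A₁ : tf₁.category}
  {hA₁ : PreFrobenioid.IsFrobeniusTrivial tf₁.toElem A₁} {hA₁' : SemiGraphs.IsGaloisObj A₁.base.obj}
  {tf₂ : TemperedFrobenioid T₂ (ConnectedPart (BTemp X₂.Pi))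
    (treeCatVocab (ConnectedPart (BTemp X₂.Pi)) IsRational₂ IsStrictlyRational₂)}
  {hZ₂ : tf₂.monoidType = MonoidType.Z} {hP₂ : ∀ B : (ConnectedPart (BTemp X₂.Pi))ᵒᵖ, IsPerfect (tf₂.Φ.carrier B)}
  {NH₂ : Subgroup (Field.absoluteGaloisGroup K') → tf₂.category → ℕ+ → Prop} {A₂ : tf₂.category}
  {hA₂ : PreFrobenioid.IsFrobeniusTrivial tf₂.toElem A₂} {hA₂' : SemiGraphs.IsGaloisObj A₂.base.obj}

/-- **Thm 4.4 (i) at the genuine connected base, WEAK vocabulary** ⇐ {Rmk 3.7.2, `hBmon₁ / hBmon₂`} — T44-L09 / T44-L09c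
are abc-iut-w5-d013's theorems over `B^temp(Π^tp_X)⁰` ([SemiAnbd] Prop 3.2).  Weak twin of
`thm44_i_mkOfConnectedTemperoid_treeVocab`. [cite: MochizukiEtTh2009, Thm 4.4 (i) p.94] -/
theorem Thm44Hyp.thm44_i_mkOfConnectedTemperoid_treeVocabWeak
    (h : Thm44Hyp (mkOfConnectedTemperoid X₁ tf₁ hZ₁ hP₁ NH₁ A₁ hA₁ hA₁')
      (mkOfConnectedTemperoid X₂ tf₂ hZ₂ hP₂ NH₂ A₂ hA₂ hA₂'))
    (h372 : TemperedFrobenioid.Remark372 D₀) (h372' : TemperedFrobenioid.Remark372 D₀')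
    (hBmon₁ : IsMonoidOn tf₁.ratFnFunctor) (hBmon₂ : IsMonoidOn tf₂.ratFnFunctor) :
    Thm44_i (V := treeMonoidVocabWeak.{w}) h :=
  h.thm44_i_treeVocabWeak h372 h372' hBmon₁ hBmon₂
    (h.galoisCompatible_mkOfConnectedTemperoid _ _ _ _ _ _ _ _ _ _ _ _ _ _)
    (h.hodotCompatible_mkOfConnectedTemperoid _ _ _ _ _ _ _ _ _ _ _ _ _ _)

/-- **Thm 4.4 (ii), fraction-pair clause, at the genuine connected base, WEAK vocabulary** for `ψ = psiModel` ⇐ {Rmk 3.7.2,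
`hBmon`}. [cite: MochizukiEtTh2009, Thm 4.4 (ii) p.94] -/
theorem Thm44Hyp.thm44_ii_mkOfConnectedTemperoid_treeVocabWeak
    (h : Thm44Hyp (mkOfConnectedTemperoid X₁ tf₁ hZ₁ hP₁ NH₁ A₁ hA₁ hA₁')
      (mkOfConnectedTemperoid X₂ tf₂ hZ₂ hP₂ NH₂ A₂ hA₂ hA₂'))
    (h372 : TemperedFrobenioid.Remark372 D₀) (h372' : TemperedFrobenioid.Remark372 D₀')
    (hBmon₁ : IsMonoidOn tf₁.ratFnFunctor) (hBmon₂ : IsMonoidOn tf₂.ratFnFunctor) :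
    Thm44_ii h (h.psiModel (tf₁.isFrobenioid_treeCatVocab_of_isMonoidOn hBmon₁)
      (tf₂.isFrobenioid_treeCatVocab_of_isMonoidOn hBmon₂)
      (h.preservesFrobeniusStructure_treeVocabWeak h372 h372' hBmon₁ hBmon₂)) :=
  thm44_ii_mkOfModelCanonical_treeVocabWeak h h372 h372' hBmon₁ hBmon₂

/-- **Thm 4.4 (iii), saturation clause, at the genuine connected base, WEAK vocabulary** for `ψ = psiModel` ⇐ {Rmk 3.7.2,
`hBmon`, T44-L15b}. [cite: MochizukiEtTh2009, Thm 4.4 (iii) p.94] -/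
theorem Thm44Hyp.thm44_iii_mkOfConnectedTemperoid_treeVocabWeak
    (h : Thm44Hyp (mkOfConnectedTemperoid X₁ tf₁ hZ₁ hP₁ NH₁ A₁ hA₁ hA₁')
      (mkOfConnectedTemperoid X₂ tf₂ hZ₂ hP₂ NH₂ A₂ hA₂ hA₂'))
    (h372 : TemperedFrobenioid.Remark372 D₀) (h372' : TemperedFrobenioid.Remark372 D₀')
    (hBmon₁ : IsMonoidOn tf₁.ratFnFunctor) (hBmon₂ : IsMonoidOn tf₂.ratFnFunctor)
    (h15 : h.PreservesNHSaturatedBsFld) :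
    Thm44_iii h (h.psiModel (tf₁.isFrobenioid_treeCatVocab_of_isMonoidOn hBmon₁)
      (tf₂.isFrobenioid_treeCatVocab_of_isMonoidOn hBmon₂)
      (h.preservesFrobeniusStructure_treeVocabWeak h372 h372' hBmon₁ hBmon₂)) :=
  h.thm44_iii_treeVocabWeak _ h372 h372' hBmon₁ hBmon₂ h15

/-- **Thm 4.4 (ii), `N`-th-roots clause (T44-L14), at the genuine connected base, WEAK vocabulary** for `ψ = psiModel` and the
model pull-backs ⇐ {Rmk 3.7.2, `hBmon`, T44-L15b} — T44-L09c discharged by abc-iut-w5-d013's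
`galoisCompatible_mkOfConnectedTemperoid`; no perf-factorial binder. [cite: MochizukiEtTh2009, Thm 4.4 (ii) p.94] -/
theorem Thm44Hyp.preservesNthRoots_mkOfConnectedTemperoid_treeVocabWeak
    (h : Thm44Hyp (mkOfConnectedTemperoid X₁ tf₁ hZ₁ hP₁ NH₁ A₁ hA₁ hA₁')
      (mkOfConnectedTemperoid X₂ tf₂ hZ₂ hP₂ NH₂ A₂ hA₂ hA₂'))
    (h372 : TemperedFrobenioid.Remark372 D₀) (h372' : TemperedFrobenioid.Remark372 D₀')
    (hBmon₁ : IsMonoidOn tf₁.ratFnFunctor) (hBmon₂ : IsMonoidOn tf₂.ratFnFunctor)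
    (h15 : h.PreservesNHSaturatedBsFld) :
    h.PreservesNthRoots (h.psiModel (tf₁.isFrobenioid_treeCatVocab_of_isMonoidOn hBmon₁)
      (tf₂.isFrobenioid_treeCatVocab_of_isMonoidOn hBmon₂)
      (h.preservesFrobeniusStructure_treeVocabWeak h372 h372' hBmon₁ hBmon₂))
      (fun φ f => tf₁.pullFracModel φ f) (fun φ f => tf₂.pullFracModel φ f) :=
  h.preservesNthRoots_mkOfModelCanonical_treeVocabWeak h372 h372' hBmon₁ hBmon₂
    (h.galoisCompatible_mkOfConnectedTemperoid _ _ _ _ _ _ _ _ _ _ _ _ _ _) h15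

/-- **[EtTh] Theorem 4.4 at the genuine connected base `B^temp(Π^tp_X)⁰` over the WEAK vocabulary, consolidated**:
(i) ∧ (ii) (fraction-pairs) ∧ (iii) (saturation) ∧ (ii) (`N`-th roots), for the settings `mkOfConnectedTemperoid` over
realified data typed with `treeMonoidVocabWeak` (the vocabulary of the coverings `Ÿ`, `Z_∞`, F-L2d2-1), the CONSTRUCTED
`ψ = Ψ^birat` and the model pull-backs — modulo ONLY {Rmk 3.7.2 (`Remark372 D₀ / D₀'`, named fact), `hBmon₁ / hBmon₂`
(Def 3.6 (ii) datum: `𝔹` a monoid on `D`), T44-L15b ([FrdII] Def 2.2 (ii))}: the weak-vocabulary twin of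
abc-iut-w5-d179's `thm44_mkOfConnectedTemperoid`, with the same residual inputs and no perf-factorial binder anywhere.
[cite: MochizukiEtTh2009, Thm 4.4 p.94] -/
theorem Thm44Hyp.thm44_mkOfConnectedTemperoid_treeVocabWeak
    (h : Thm44Hyp (mkOfConnectedTemperoid X₁ tf₁ hZ₁ hP₁ NH₁ A₁ hA₁ hA₁')
      (mkOfConnectedTemperoid X₂ tf₂ hZ₂ hP₂ NH₂ A₂ hA₂ hA₂'))
    (h372 : TemperedFrobenioid.Remark372 D₀) (h372' : TemperedFrobenioid.Remark372 D₀')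
    (hBmon₁ : IsMonoidOn tf₁.ratFnFunctor) (hBmon₂ : IsMonoidOn tf₂.ratFnFunctor)
    (h15 : h.PreservesNHSaturatedBsFld) :
    Thm44_i h ∧
      Thm44_ii h (h.psiModel (tf₁.isFrobenioid_treeCatVocab_of_isMonoidOn hBmon₁)
        (tf₂.isFrobenioid_treeCatVocab_of_isMonoidOn hBmon₂)
        (h.preservesFrobeniusStructure_treeVocabWeak h372 h372' hBmon₁ hBmon₂)) ∧
      Thm44_iii h (h.psiModel (tf₁.isFrobenioid_treeCatVocab_of_isMonoidOn hBmon₁)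
        (tf₂.isFrobenioid_treeCatVocab_of_isMonoidOn hBmon₂)
        (h.preservesFrobeniusStructure_treeVocabWeak h372 h372' hBmon₁ hBmon₂)) ∧
      h.PreservesNthRoots (h.psiModel (tf₁.isFrobenioid_treeCatVocab_of_isMonoidOn hBmon₁)
        (tf₂.isFrobenioid_treeCatVocab_of_isMonoidOn hBmon₂)
        (h.preservesFrobeniusStructure_treeVocabWeak h372 h372' hBmon₁ hBmon₂))
        (fun φ f => tf₁.pullFracModel φ f) (fun φ f => tf₂.pullFracModel φ f) :=
  ⟨h.thm44_i_mkOfConnectedTemperoid_treeVocabWeak h372 h372' hBmon₁ hBmon₂,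
    h.thm44_ii_mkOfConnectedTemperoid_treeVocabWeak h372 h372' hBmon₁ hBmon₂,
    h.thm44_iii_mkOfConnectedTemperoid_treeVocabWeak h372 h372' hBmon₁ hBmon₂ h15,
    h.preservesNthRoots_mkOfConnectedTemperoid_treeVocabWeak h372 h372' hBmon₁ hBmon₂ h15⟩

end Connected

end BiKummerSetting

end Literature.AnabelianGeometry.EtaleTheta

end
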